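import Summits.Ventures.AbcSig.Rows.XTemplateBC7
import Summits.Ventures.AbcSig.Levels.N2738M6Chi
import Summits.Ventures.AbcSig.Levels.N2738

/-!
# Venture AbcSig — ROW `XnA7Yn37Z2V2`: `xⁿ + 2^α yⁿ = 37 z²` (`7 ≤ α < n`) over the tree level 2738 (GENERATED by p-lean g5 with `gen4/cprow.py`, M6χ kernel discharge kept from the v1 row)

HONEST FRAMING. A row of a COMPUTATION cell (`pub-abcsig`); a CONDITIONAL theorem, no claim on ABC or any summit.
Hypotheses: `BS04Package` (CITED: [BS04] Lemma 3.3 + (3.1) + Lemma 4.2); per level `DataComplete` (COMPUTED: the orbit list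
of the certified engine level file is complete) and, for the norm-form level files, `RefinesCPSymAll` (COMPUTED: the listed
characteristic polynomials annihilate `± c_ℓ` on the newforms matching each orbit datum — same engine file); and the listed
per-orbit exclusions `hX_…` (CITED: the row of record names the printed argument / cell module for each — [BS04, Prop. 4.4 /
4.6], M4 Kraus, M6c, M2·; nothing of those is checked here). Everything else is kernel-checked: the recipe templates and the
level files 2738 (ordinary ℤ[θ] certificates). Exponent range: prime `n ≥ 11`, `n ∤ 37`.
v2: the v1 residual exponent 11 is now INCLUDED. CITED per the row of record at n = 11: 2738.9/.10 by MODULE M9 (local type at 37 via the character trace formula, pin lit/LOCALTYPE-PIN.md); other cited orbits exactly as in the v1 row; everything else is killed in the kernel by the tree certificates of level 2738.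
Residues / orbits left as CITED hypotheses: N2738 orbit_2738_9 @ [11]: CITED hX_; N2738 orbit_2738_10 @ [11]: CITED hX_. Kernel module certificate used (as in the v1 row): M6χ at 2738.12 for n = 19 (`Levels/N2738M6Chi.lean`; `EisChiPackage` CITED, `Refines` COMPUTED).
Row of record: `census/rows/C1b/C1b-C37-a7plus.md` (sha16 `eeaacd143d4eb62f`; v2 row of record (supersession LOCALTYPE v2, R8-signed; see the row's R8 cell); v1 Lean row Rows/XnA7Yn37Z2X.lean keeps residual {11}); p1's statement of record: `Rows.C1bCell 37 Rows.AlphaGe7Reduced 11 ∅` (`Rows/StatementsC1b.lean` / `Rows/Statements.lean`).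
-/

namespace Summit.Ventures.AbcSig

/-- Row `XnA7Yn37Z2V2`: no primitive solution of `xⁿ + 2^α yⁿ = 37 z²` (`7 ≤ α < n`) for prime `n ≥ 11`, `n ∤ 37`,
conditional on the named hypotheses (norm-form level certificates in the kernel). -/
theorem xrow_XnA7Yn37Z2V2 (M : NewformModel) (hP : M.BS04Package) (hEχ : M.EisChiPackage)
    (hD2738 : M.DataComplete 2738 level2738Orbits)
    (hRc_orbit_2738_12 : M.Refines 2738 orbit_2738_12 m6chiX_2738_12)
    (n : ℕ) (hn : n.Prime) (hmin : 11 ≤ n) (hnC : ¬ n ∣ 37) (α : ℕ) (hα7 : 7 ≤ α) (hαn : α < n)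
    (hX_orbit_2738_9 : n ∈ ([11] : List ℕ) → M.Excludes 2738 orbit_2738_9
      (famBCge7 37 n))
    (hX_orbit_2738_10 : n ∈ ([11] : List ℕ) → M.Excludes 2738 orbit_2738_10
      (famBCge7 37 n))
    (x y z : ℤ) (hxy1 : x * y ≠ 1) (hxy2 : x * y ≠ -1) : ¬ IsPrimitiveSolution 1 (2 ^ α) 37 n x y z := by
  have h7 : 7 ≤ n := by omega
  have hC : Nat.Prime 37 := by norm_num
  have hsq : Squarefree (37 : ℕ) := (Nat.prime_iff.mp hC).squarefree
  exact xbranchBC_ge7 α 37 hsq (by decide) M hP hD2738 n hn h7 hnC hα7 hαn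
    (level2738_sieve n hn h7 (fun o => M.Excludes 2738 o
      (famBCge7 37 n) ∨ M.ExcludesStd 2738 o n) (fun hmem => by
      obtain rfl : n = 7 := by simpa using hmem
      omega) (fun hmem => by
      obtain rfl : n = 7 := by simpa using hmem
      omega) (fun hmem => by
      obtain rfl : n = 7 := by simpa using hmem
      omega) (fun hmem => by
      obtain rfl : n = 7 := by simpa using hmem
      omega) (fun hmem => by
      obtain rfl : n = 7 := by simpa using hmem
      omega) (fun hmem => by
      obtain rfl : n = 7 := by simpa using hmem
      omega) (fun hmem => by
      obtain rfl : n = 11 := by simpa using hmem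
      exact Or.inl (hX_orbit_2738_9 (by simp))) (fun hmem => by
      obtain rfl : n = 11 := by simpa using hmem
      exact Or.inl (hX_orbit_2738_10 (by simp))) (fun hmem => by
      obtain rfl : n = 19 := by simpa using hmem
      exact Or.inr (m6chi_2738_12_n19_excludes M hEχ hRc_orbit_2738_12)) (fun hmem => by
      obtain rfl : n = 7 := by simpa using hmem
      omega) (fun hmem => by
      obtain rfl : n = 7 := by simpa using hmem
      omega) (fun hmem => by
      obtain rfl : n = 37 := by simpa using hmem
      exact absurd (dvd_refl 37) hnC) (fun hmem => by
      obtain rfl : n = 37 := by simpa using hmem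
      exact absurd (dvd_refl 37) hnC))
    x y z hxy1 hxy2

end Summit.Ventures.AbcSig
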